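import Literature.AnabelianGeometry.EtaleTheta.ThetaRigidityToy
import Mathlib.Data.Int.Cast.Lemmas
import HarnessLib

/-!
# A nonabelian degenerate `Π^tp_X` for the [EtTh] §2 interface `RigidData`: the group
# `((𝔽₂⁴ ⋊ C₂) × C₂) ⋊ ℤ`

Group-theoretic preliminaries for the level-`2` "twisted" toy of `RigidData` (cell `abc-iut`,
`ThetaRigidityToyTwisted.lean`), built to witness the SCHEMA status of [EtTh] Cor. 2.18 (ii) and
Prop. 2.14 (ii) over the lawless interface (FACT rows F-0621, F-0632): those two rows HOLD at every
abelian toy (`ThetaRigidityToy`, `ThetaRigidityToyLevelThree`), because there the "difference of two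
theta sections" always extends from `Π^tp_Ÿ` to `Π^tp_Y`.  The obstruction needs:

* `V := 𝔽₂⁴ = (ℤ/2)² × (ℤ/2)²` (multiplicative), the involution `JJ` acting on each block by the
  unipotent Jordan block (`(u₁,u₂) ↦ (u₁u₂, u₂)`), and the block swap `MulEquiv.prodComm`;
* `PiY0 := V ⋊ C₂` (`C₂` acting through `JJ`), `N := PiY0 × C₂` (the extra central `C₂` will be
  `(l·Δ_Θ)`), the involution `Theta := swap × id` of `N`, and the action `Phi : ℤ → Aut(N)` through
  the parity of `ℤ` (`n ↦ Thetaⁿ`);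
* `P := N ⋊[Phi] ℤ` — the toy `Π^tp_X` — with `Π^tp_Y := Ker(P ↠ ℤ) ≅ N`, the `C₂`-exponent `epsP`,
  the central copy `iotaL : C₂ → P`, and the element `x := (1, 1_ℤ)` conjugating `N` by `Theta`.

Pure finite group theory over Mathlib's `SemidirectProduct`; no topology, no instances, no notation.
Written by the cell `abc-iut` (seat abc-iut-w5-d175; F-TRANCHES 146/149 of D-0078 (S1)).  Nothing here
is a statement about [EtTh]; no side taken on [IUTchIII] Cor. 3.12.

Reference: [MochizukiEtTh2009] S. Mochizuki, *The étale theta function …*, Publ. RIMS 45 (2009):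
Def. 2.13 pp.47–48, Prop. 2.14 (ii) p.49, Cor. 2.18 (ii) p.60 (PRIMS text pages).
-/

namespace Literature.AnabelianGeometry.EtaleTheta

namespace RigidData

namespace ToyTw

open RigidData.Toy (M2 g g_ne_one)

/-! ## §1. `ℤ/2`: involution homomorphisms -/

/-- In `ℤ/2`, `t·t = 1`. [cite: MochizukiEtTh2009, Def 2.13 p.47] -/
theorem M2_mul_self (t : M2) : t * t = 1 := by
  revert t; decide

/-- In `ℤ/2`, an element `≠ 1` is the generator. [cite: MochizukiEtTh2009, Def 2.13 p.47] -/
theorem M2_eq_g_of_ne_one {t : M2} (h : t ≠ 1) : t = g := by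
  revert t; decide

/-- The homomorphism `ℤ/2 → G` determined by an involution `a` (`a·a = 1`): `1 ↦ 1`, `g ↦ a`.
[cite: MochizukiEtTh2009, Def 2.13 p.47] -/
def invHom {G : Type*} [Group G] (a : G) (ha : a * a = 1) : M2 →* G where
  toFun c := if c = 1 then 1 else a
  map_one' := if_pos rfl
  map_mul' c c' := by
    by_cases hc : c = 1
    · subst hc; simp
    by_cases hc' : c' = 1
    · subst hc'; simp
    rw [M2_eq_g_of_ne_one hc, M2_eq_g_of_ne_one hc', M2_mul_self, if_pos rfl, if_neg g_ne_one, ha]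

/-- `invHom a _ c` is `1` or `a`. [cite: MochizukiEtTh2009, Def 2.13 p.47] -/
theorem invHom_apply_eq {G : Type*} [Group G] (a : G) (ha : a * a = 1) (c : M2) :
    invHom a ha c = 1 ∨ invHom a ha c = a := by
  by_cases hc : c = 1
  · exact Or.inl (if_pos hc)
  · exact Or.inr (if_neg hc)

/-- `invHom a _ g = a`. [cite: MochizukiEtTh2009, Def 2.13 p.47] -/
theorem invHom_g {G : Type*} [Group G] (a : G) (ha : a * a = 1) : invHom a ha g = a :=
  show (if g = 1 then (1 : G) else a) = a from if_neg g_ne_one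

/-! ## §2. `V = 𝔽₂⁴`, the diagonal unipotent involution `JJ`, and `PiY0 = V ⋊ C₂` -/

/-- `V := (ℤ/2)² × (ℤ/2)²`, coordinates `((u₁, u₂), (v₁, v₂))`. [cite: MochizukiEtTh2009, Def 2.13 p.47] -/
abbrev V : Type := (M2 × M2) × (M2 × M2)

/-- The diagonal unipotent involution `((u₁,u₂),(v₁,v₂)) ↦ ((u₁u₂, u₂),(v₁v₂, v₂))` as a function.
[cite: MochizukiEtTh2009, Def 2.13 p.47] -/
def jj (v : V) : V := ((v.1.1 * v.1.2, v.1.2), (v.2.1 * v.2.2, v.2.2))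

/-- `jj` is an involution. [cite: MochizukiEtTh2009, Def 2.13 p.47] -/
theorem jj_jj (v : V) : jj (jj v) = v := by
  obtain ⟨⟨a, b⟩, ⟨c, d⟩⟩ := v
  simp only [jj, mul_assoc, M2_mul_self, mul_one]

/-- `jj` is multiplicative. [cite: MochizukiEtTh2009, Def 2.13 p.47] -/
theorem jj_mul (v w : V) : jj (v * w) = jj v * jj w := by
  obtain ⟨⟨a, b⟩, ⟨c, d⟩⟩ := v
  obtain ⟨⟨a', b'⟩, ⟨c', d'⟩⟩ := w
  simp only [jj, Prod.mk_mul_mk, Prod.mk.injEq]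
  exact ⟨⟨mul_mul_mul_comm _ _ _ _, trivial⟩, mul_mul_mul_comm _ _ _ _, trivial⟩

/-- `JJ : V ≃* V`, the diagonal unipotent involution. [cite: MochizukiEtTh2009, Def 2.13 p.47] -/
def JJ : V ≃* V :=
  { toFun := jj, invFun := jj, left_inv := jj_jj, right_inv := jj_jj, map_mul' := jj_mul }

/-- `JJ · JJ = 1` in `Aut(V)`. [cite: MochizukiEtTh2009, Def 2.13 p.47] -/
theorem JJ_mul_JJ : JJ * JJ = 1 := MulEquiv.ext fun v => jj_jj v

/-- The action of `C₂` on `V` through `JJ`. [cite: MochizukiEtTh2009, Def 2.13 p.47] -/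
def phiTau : M2 →* MulAut V := invHom JJ JJ_mul_JJ

/-- `PiY0 := V ⋊ C₂`, the finite nonabelian core of the toy `Π^tp_Y`. [cite: MochizukiEtTh2009, Def 2.13 p.47] -/
abbrev PiY0 : Type := V ⋊[phiTau] M2

/-- The block swap commutes with `phiTau c`. [cite: MochizukiEtTh2009, Def 2.13 p.47] -/
theorem phiTau_comm_swap (c : M2) :
    (phiTau c).trans (MulEquiv.prodComm : V ≃* V) = (MulEquiv.prodComm : V ≃* V).trans (phiTau c) := by
  rcases invHom_apply_eq JJ JJ_mul_JJ c with h | h <;> rw [phiTau, h]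
  · rfl
  · refine MulEquiv.ext fun v => ?_
    obtain ⟨⟨a, b⟩, ⟨c, d⟩⟩ := v
    rfl

/-- `theta0 : PiY0 ≃* PiY0`, swapping the two `𝔽₂²`-blocks and fixing `C₂`.
[cite: MochizukiEtTh2009, Def 2.13 p.47] -/
def theta0 : PiY0 ≃* PiY0 :=
  SemidirectProduct.congr (MulEquiv.prodComm : V ≃* V) (MulEquiv.refl M2) phiTau_comm_swap

/-- `theta0` on components. [cite: MochizukiEtTh2009, Def 2.13 p.47] -/
theorem theta0_apply (p : PiY0) : theta0 p = ⟨(p.left.2, p.left.1), p.right⟩ := rfl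

/-! ## §3. `N = PiY0 × C₂`, the involution `Theta`, the parity action of `ℤ`, and `P = N ⋊ ℤ` -/

/-- `N := PiY0 × C₂` (the second factor will be `(l·Δ_Θ)`). [cite: MochizukiEtTh2009, Def 2.13 p.47] -/
abbrev N : Type := PiY0 × M2

/-- `Theta := theta0 × id`, an involution of `N`. [cite: MochizukiEtTh2009, Def 2.13 p.47] -/
def Theta : N ≃* N := MulEquiv.prodCongr theta0 (MulEquiv.refl M2)

/-- `Theta` on components. [cite: MochizukiEtTh2009, Def 2.13 p.47] -/
theorem Theta_apply (n : N) : Theta n = (⟨(n.1.left.2, n.1.left.1), n.1.right⟩, n.2) := rfl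

/-- `Theta · Theta = 1` in `Aut(N)`. [cite: MochizukiEtTh2009, Def 2.13 p.47] -/
theorem Theta_mul_Theta : Theta * Theta = 1 := by
  refine MulEquiv.ext fun n => ?_
  obtain ⟨⟨⟨v1, v2⟩, c⟩, m⟩ := n
  rfl

/-- The action `ℤ → Aut(N)` through the parity of `ℤ`: even ↦ `1`, odd ↦ `Theta`.
[cite: MochizukiEtTh2009, Def 2.13 p.47] -/
def Phi : Multiplicative ℤ →* MulAut N :=
  (invHom Theta Theta_mul_Theta).comp (AddMonoidHom.toMultiplicative (Int.castAddHom (ZMod 2)))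

/-- `Phi z` is `1` or `Theta`. [cite: MochizukiEtTh2009, Def 2.13 p.47] -/
theorem Phi_apply_eq (z : Multiplicative ℤ) : Phi z = 1 ∨ Phi z = Theta :=
  invHom_apply_eq Theta Theta_mul_Theta _

/-- `Phi` of the generator `1 ∈ ℤ` is `Theta`. [cite: MochizukiEtTh2009, Def 2.13 p.47] -/
theorem Phi_one : Phi (Multiplicative.ofAdd 1) = Theta := by
  change invHom Theta Theta_mul_Theta (Multiplicative.ofAdd (((1 : ℤ) : ZMod 2))) = Theta
  exact invHom_g _ _

/-- **The toy `Π^tp_X`**: `P := N ⋊[Phi] ℤ`. [cite: MochizukiEtTh2009, Def 2.13 p.47] -/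
abbrev P : Type := N ⋊[Phi] Multiplicative ℤ

/-- `Π^tp_Y := Ker(P ↠ ℤ)`. [cite: MochizukiEtTh2009, Def 2.13 p.47] -/
abbrev PiY : Subgroup P := (SemidirectProduct.rightHom : P →* Multiplicative ℤ).ker

/-- Membership in `Π^tp_Y`: the `ℤ`-component is `1`. [cite: MochizukiEtTh2009, Def 2.13 p.47] -/
theorem mem_PiY_iff (p : P) : p ∈ PiY ↔ p.right = 1 := MonoidHom.mem_ker

/-- The `C₂`-exponent of `N`: `(⟨v, c⟩, m) ↦ c`. [cite: MochizukiEtTh2009, Def 2.13 p.47] -/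
def epsN : N →* M2 := SemidirectProduct.rightHom.comp (MonoidHom.fst PiY0 M2)

/-- `epsN` is `Phi`-invariant. [cite: MochizukiEtTh2009, Def 2.13 p.47] -/
theorem epsN_Phi (z : Multiplicative ℤ) (n : N) : epsN (Phi z n) = epsN n := by
  rcases Phi_apply_eq z with h | h <;> rw [h]
  · rfl
  · rfl

/-- The `C₂`-exponent extended to `P = N ⋊ ℤ` (a homomorphism since `epsN` is `Phi`-invariant).
[cite: MochizukiEtTh2009, Def 2.13 p.47] -/
def epsP : P →* M2 where
  toFun p := epsN p.left
  map_one' := by simp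
  map_mul' p q := by
    rw [SemidirectProduct.mul_left, map_mul, epsN_Phi]

/-- `epsP` on components. [cite: MochizukiEtTh2009, Def 2.13 p.47] -/
theorem epsP_apply (p : P) : epsP p = p.left.1.right := rfl

/-- `Π^tp_Ÿ := Ker(epsP) ∩ Π^tp_Y` (elements `(⟨v, 1⟩, m, 1_ℤ)`). [cite: MochizukiEtTh2009, Def 2.13 p.47] -/
abbrev PiYdd : Subgroup P := epsP.ker ⊓ PiY

/-- Membership in `Π^tp_Ÿ`. [cite: MochizukiEtTh2009, Def 2.13 p.47] -/
theorem mem_PiYdd_iff (p : P) : p ∈ PiYdd ↔ p.left.1.right = 1 ∧ p.right = 1 := by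
  rw [Subgroup.mem_inf, MonoidHom.mem_ker, mem_PiY_iff, epsP_apply]

/-- The central copy `C₂ → P`, `m ↦ ((1, m), 1_ℤ)` — it will be `(l·Δ_Θ)`.
[cite: MochizukiEtTh2009, Def 2.13 p.47] -/
def iotaL : M2 →* P := (SemidirectProduct.inl : N →* P).comp (MonoidHom.inr PiY0 M2)

/-- `iotaL m` on components. [cite: MochizukiEtTh2009, Def 2.13 p.47] -/
theorem iotaL_apply (m : M2) : iotaL m = SemidirectProduct.inl ((1 : PiY0), m) := rfl

/-- `Phi z` fixes `(1, m)`. [cite: MochizukiEtTh2009, Def 2.13 p.47] -/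
theorem Phi_apply_one_inr (z : Multiplicative ℤ) (m : M2) : Phi z ((1 : PiY0), m) = ((1 : PiY0), m) := by
  rcases Phi_apply_eq z with h | h <;> rw [h]
  · rfl
  · rfl

/-- `iotaL m` is central in `P`. [cite: MochizukiEtTh2009, Def 2.13 p.47] -/
theorem iotaL_comm (p : P) (m : M2) : p * iotaL m = iotaL m * p := by
  rw [iotaL_apply]
  refine SemidirectProduct.ext ?_ ?_
  · rw [SemidirectProduct.mul_left, SemidirectProduct.mul_left, SemidirectProduct.left_inl,
      SemidirectProduct.right_inl, map_one, MulAut.one_apply, Phi_apply_one_inr]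
    obtain ⟨⟨q, m'⟩, z⟩ := p
    change (q * 1, m' * m) = (1 * q, m * m')
    rw [mul_one, one_mul, mul_comm m']
  · rw [SemidirectProduct.mul_right, SemidirectProduct.mul_right, SemidirectProduct.right_inl,
      mul_one, one_mul]

/-- `(l·Δ_Θ) := Im(iotaL)`. [cite: MochizukiEtTh2009, Prop 2.12 p.45] -/
abbrev L : Subgroup P := iotaL.range

/-- `L` is normal (indeed central). [cite: MochizukiEtTh2009, Prop 2.12 p.45] -/
theorem L_normal : (L : Subgroup P).Normal :=
  ⟨fun _ ⟨m, hm⟩ p => ⟨m, by rw [← hm, iotaL_comm p m, mul_inv_cancel_right]⟩⟩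

/-- `L ≤ Π^tp_Ÿ`. [cite: MochizukiEtTh2009, Prop 2.12 p.45] -/
theorem L_le_PiYdd : (L : Subgroup P) ≤ PiYdd := by
  rintro _ ⟨m, rfl⟩
  rw [mem_PiYdd_iff]
  exact ⟨rfl, rfl⟩

/-- The element `x := (1_N, 1_ℤ)` of `P`, conjugation by which acts on `N` through `Theta`.
[cite: MochizukiEtTh2009, Def 2.13 p.47] -/
def x : P := SemidirectProduct.inr (Multiplicative.ofAdd 1)

/-- `x⁻¹ · (n, 0) · x = (Theta n, 0)`. [cite: MochizukiEtTh2009, Def 2.13 p.47] -/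
theorem x_inv_mul_inl_mul_x (n : N) :
    x⁻¹ * SemidirectProduct.inl n * x = SemidirectProduct.inl (Theta n) := by
  have hinv : (Phi (Multiplicative.ofAdd (1 : ℤ)))⁻¹ = Theta := by
    rw [Phi_one]; exact inv_eq_of_mul_eq_one_right Theta_mul_Theta
  have h := SemidirectProduct.inl_aut_inv (φ := Phi) (Multiplicative.ofAdd (1 : ℤ)) n
  rw [hinv] at h
  rw [x, ← map_inv]
  exact h.symm

/-- An element of `Π^tp_Y` is `(n, 0)` for its `N`-component. [cite: MochizukiEtTh2009, Def 2.13 p.47] -/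
theorem eq_inl_of_mem_PiY {p : P} (hp : p ∈ PiY) : p = SemidirectProduct.inl p.left := by
  rw [mem_PiY_iff] at hp
  exact SemidirectProduct.ext (by simp) (by simp [hp])

/-- Left components multiply on `Π^tp_Y`. [cite: MochizukiEtTh2009, Def 2.13 p.47] -/
theorem left_mul_of_mem_PiY {p : P} (hp : p ∈ PiY) (q : P) : (p * q).left = p.left * q.left := by
  rw [mem_PiY_iff] at hp
  rw [SemidirectProduct.mul_left, hp, map_one, MulAut.one_apply]

/-- Left components multiply on `V ⋊ C₂` when the first factor has trivial `C₂`-part.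
[cite: MochizukiEtTh2009, Def 2.13 p.47] -/
theorem vleft_mul_of_right_eq_one {p : PiY0} (hp : p.right = 1) (q : PiY0) :
    (p * q).left = p.left * q.left := by
  rw [SemidirectProduct.mul_left, hp, map_one, MulAut.one_apply]

/-- The element `y := ((1_V, g), 1, 0)` of `Π^tp_Y ∖ Π^tp_Ÿ`; conjugation by it acts on `V` by `JJ`.
[cite: MochizukiEtTh2009, Def 2.13 p.47] -/
def y : P := SemidirectProduct.inl ((SemidirectProduct.inr g : PiY0), (1 : M2))

/-- `y ∈ Π^tp_Y`. [cite: MochizukiEtTh2009, Def 2.13 p.47] -/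
theorem y_mem_PiY : y ∈ PiY := (mem_PiY_iff _).mpr rfl

/-- The test element `g₀ := ((((1,g),(1,1)), 1), 1, 0) ∈ Π^tp_Ÿ` (`u₂ = g`, all other coordinates
trivial). [cite: MochizukiEtTh2009, Def 2.13 p.47] -/
def g0 : P := SemidirectProduct.inl ((SemidirectProduct.inl (((1, g), (1, 1)) : V) : PiY0), (1 : M2))

/-- `g₀ ∈ Π^tp_Ÿ`. [cite: MochizukiEtTh2009, Def 2.13 p.47] -/
theorem g0_mem_PiYdd : g0 ∈ PiYdd := (mem_PiYdd_iff _).mpr ⟨rfl, rfl⟩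

/-- `y g₀ y⁻¹ = ((((g,g),(1,1)), 1), 1, 0)`: conjugation by `y` applies `JJ` to the `V`-part.
[cite: MochizukiEtTh2009, Def 2.13 p.47] -/
theorem y_conj_g0 :
    y * g0 * y⁻¹ =
      SemidirectProduct.inl ((SemidirectProduct.inl (((g, g), (1, 1)) : V) : PiY0), (1 : M2)) := by
  rw [y, g0, ← map_inv, ← map_mul, ← map_mul]
  congr 1

/-- `y g₀ y⁻¹ ∈ Π^tp_Ÿ`. [cite: MochizukiEtTh2009, Def 2.13 p.47] -/
theorem y_conj_g0_mem_PiYdd : y * g0 * y⁻¹ ∈ PiYdd := by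
  rw [y_conj_g0, mem_PiYdd_iff]
  exact ⟨rfl, rfl⟩

end ToyTw

end RigidData

end Literature.AnabelianGeometry.EtaleTheta
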